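import Mathlib
import HarnessLib

/-!
# Three summable sizes: `Σ Mⁿ e^{-κ gⁿ}`, `Σ Mⁿ λ^{-n²}`, `Σ (1 + n² L)^q g^{-n}`

Cell `ns-blowup`, seat `ns-blowup-fc-prover-1` (D-0074 GROUP C «bridge support», door N1-FC); real
analysis used by the cascade-gluing files over `TriggeredTransfer.lean` (`TriggeredTransferClock.lean`:
the blow-up time `Σ_n T_n λ^{-2n}` is finite because the level clock is polynomial in the level while
the amplitudes climb geometrically; the `C^m` sizes `λ^{n(3+2m)} ε_n` of the zoomed triggers are
summable because the seeds are `ε_n ≤ e^{-κ growthⁿ} + λ^{-n²}`). LABEL: E–C bookkeeping (pure real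
analysis, ratio test and comparison with `n^k rⁿ`). WHAT THIS IS NOT: not Navier–Stokes — no fluid
object appears. 0 sorry; axioms ⊆ {propext, Classical.choice, Quot.sound}. [folklore]
-/

noncomputable section

namespace Summit.NavierStokesRegularity.FluidComputer.TriggeredTransfer

open Set Filter Function Finset
open scoped Topology BigOperators

/-! ## Three summable sizes (real analysis) -/

/-- `Σ_n Mⁿ · exp (-κ gⁿ) < ∞` for `M, κ > 0`, `g > 1`: a double exponential beats any
exponential (ratio test: the ratio is `M exp (-κ (g-1) gⁿ) → 0`). [folklore] -/
theorem summable_pow_mul_exp_neg_mul_pow {M κ g : ℝ} (hM : 0 < M) (hκ : 0 < κ) (hg : 1 < g) :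
    Summable (fun n : ℕ => M ^ n * Real.exp (-(κ * g ^ n))) := by
  refine summable_of_ratio_test_tendsto_lt_one (l := 0) zero_lt_one ?_ ?_
  · exact Eventually.of_forall fun n => (mul_pos (pow_pos hM n) (Real.exp_pos _)).ne'
  · have hq : (fun n : ℕ => ‖M ^ (n + 1) * Real.exp (-(κ * g ^ (n + 1)))‖ /
        ‖M ^ n * Real.exp (-(κ * g ^ n))‖) = fun n => M * Real.exp (-(κ * (g - 1) * g ^ n)) := by
      funext n
      have h1 : 0 < M ^ n := pow_pos hM n
      have h2 : 0 < Real.exp (-(κ * g ^ n)) := Real.exp_pos _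
      have hden : M ^ n * Real.exp (-(κ * g ^ n)) ≠ 0 := (mul_pos h1 h2).ne'
      rw [Real.norm_of_nonneg (by positivity), Real.norm_of_nonneg (by positivity),
        show -(κ * g ^ (n + 1)) = -(κ * (g - 1) * g ^ n) + -(κ * g ^ n) by ring, Real.exp_add,
        pow_succ, show M ^ n * M * (Real.exp (-(κ * (g - 1) * g ^ n)) * Real.exp (-(κ * g ^ n))) =
          (M * Real.exp (-(κ * (g - 1) * g ^ n))) * (M ^ n * Real.exp (-(κ * g ^ n))) by ring,
        mul_div_assoc, div_self hden, mul_one]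
    rw [hq]
    have h1 : Tendsto (fun n : ℕ => κ * (g - 1) * g ^ n) atTop atTop :=
      (tendsto_pow_atTop_atTop_of_one_lt hg).const_mul_atTop (mul_pos hκ (by linarith))
    have h2 := (Real.tendsto_exp_neg_atTop_nhds_zero.comp h1).const_mul M
    simpa using h2

/-- `Σ_n Mⁿ · λ^{-n²} < ∞` for `M > 0`, `λ > 1`: a Gaussian in the level beats any exponential
(ratio test: the ratio is `M / λ^{2n+1} → 0`). [folklore] -/
theorem summable_pow_mul_pow_sq_inv {M g : ℝ} (hM : 0 < M) (hg : 1 < g) :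
    Summable (fun n : ℕ => M ^ n * (g ^ (n ^ 2))⁻¹) := by
  have hg0 : 0 < g := zero_lt_one.trans hg
  refine summable_of_ratio_test_tendsto_lt_one (l := 0) zero_lt_one ?_ ?_
  · exact Eventually.of_forall fun n => (mul_pos (pow_pos hM n) (inv_pos.2 (pow_pos hg0 _))).ne'
  · have hq : (fun n : ℕ => ‖M ^ (n + 1) * (g ^ ((n + 1) ^ 2))⁻¹‖ / ‖M ^ n * (g ^ (n ^ 2))⁻¹‖) =
        fun n => M / g ^ (2 * n + 1) := by
      funext n
      have h1 : 0 < M ^ n := pow_pos hM n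
      have h2 : 0 < g ^ (n ^ 2) := pow_pos hg0 _
      have h3 : 0 < g ^ (2 * n + 1) := pow_pos hg0 _
      have hden : M ^ n * (g ^ (n ^ 2))⁻¹ ≠ 0 := (mul_pos h1 (inv_pos.2 h2)).ne'
      have hg' : g ^ ((n + 1) ^ 2) = g ^ (n ^ 2) * g ^ (2 * n + 1) := by
        rw [← pow_add]; congr 1; ring
      rw [Real.norm_of_nonneg (by positivity), Real.norm_of_nonneg (by positivity), hg', pow_succ,
        mul_inv, show M ^ n * M * ((g ^ (n ^ 2))⁻¹ * (g ^ (2 * n + 1))⁻¹) =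
          (M * (g ^ (2 * n + 1))⁻¹) * (M ^ n * (g ^ (n ^ 2))⁻¹) by ring,
        mul_div_assoc, div_self hden, mul_one, div_eq_mul_inv]
    rw [hq]
    have h1 : Tendsto (fun n : ℕ => g ^ (2 * n + 1)) atTop atTop :=
      (tendsto_pow_atTop_atTop_of_one_lt hg).comp
        (tendsto_atTop_atTop.2 fun b => ⟨b, fun n hn => by omega⟩)
    exact tendsto_const_nhds.div_atTop h1

/-- `Σ_n (1 + n² L)^q / gⁿ < ∞` for `L ≥ 0`, `g > 1` (polynomial over exponential; comparison with
`(n+1)^{2q} g^{-n}`, Mathlib `summable_pow_mul_geometric_of_norm_lt_one`). [folklore] -/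
theorem summable_poly_div_pow {L g : ℝ} (hL : 0 ≤ L) (hg : 1 < g) (q : ℕ) :
    Summable (fun n : ℕ => (1 + (n : ℝ) ^ 2 * L) ^ q / g ^ n) := by
  have hg0 : 0 < g := zero_lt_one.trans hg
  have hr : ‖g⁻¹‖ < 1 := by
    rw [Real.norm_of_nonneg (inv_nonneg.2 hg0.le)]
    exact inv_lt_one_of_one_lt₀ hg
  -- `(n+1)^{2q} g^{-(n+1)}` is summable (shift of `n^{2q} g^{-n}`)
  have h1 : Summable (fun n : ℕ => (((n + 1 : ℕ) : ℝ)) ^ (2 * q) * g⁻¹ ^ (n + 1)) :=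
    (summable_nat_add_iff (f := fun n : ℕ => (n : ℝ) ^ (2 * q) * g⁻¹ ^ n) 1).2
      (summable_pow_mul_geometric_of_norm_lt_one (2 * q) hr)
  have h2 : Summable (fun n : ℕ => (1 + L) ^ q * g * ((((n + 1 : ℕ) : ℝ)) ^ (2 * q) * g⁻¹ ^ (n + 1))) :=
    h1.mul_left _
  refine h2.of_nonneg_of_le (fun n => by positivity) (fun n => ?_)
  have hpoly : (1 + (n : ℝ) ^ 2 * L) ^ q ≤ (1 + L) ^ q * ((n + 1 : ℕ) : ℝ) ^ (2 * q) := by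
    have hle : 1 + (n : ℝ) ^ 2 * L ≤ (1 + L) * ((n + 1 : ℕ) : ℝ) ^ 2 := by
      have hn : (0 : ℝ) ≤ n := Nat.cast_nonneg n
      have ha : (1 : ℝ) ≤ ((n : ℝ) + 1) ^ 2 := one_le_pow₀ (by linarith)
      have hb : L * (n : ℝ) ^ 2 ≤ L * ((n : ℝ) + 1) ^ 2 :=
        mul_le_mul_of_nonneg_left (by nlinarith) hL
      push_cast
      nlinarith
    calc (1 + (n : ℝ) ^ 2 * L) ^ q ≤ ((1 + L) * ((n + 1 : ℕ) : ℝ) ^ 2) ^ q :=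
          pow_le_pow_left₀ (by positivity) hle q
      _ = (1 + L) ^ q * ((n + 1 : ℕ) : ℝ) ^ (2 * q) := by rw [mul_pow, ← pow_mul]
  have hgeom : (1 : ℝ) / g ^ n = g * g⁻¹ ^ (n + 1) := by
    rw [pow_succ, inv_pow]
    field_simp
  calc (1 + (n : ℝ) ^ 2 * L) ^ q / g ^ n = (1 + (n : ℝ) ^ 2 * L) ^ q * (1 / g ^ n) := by ring
    _ ≤ ((1 + L) ^ q * ((n + 1 : ℕ) : ℝ) ^ (2 * q)) * (1 / g ^ n) :=
        mul_le_mul_of_nonneg_right hpoly (by positivity)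
    _ = (1 + L) ^ q * g * ((((n + 1 : ℕ) : ℝ)) ^ (2 * q) * g⁻¹ ^ (n + 1)) := by
        rw [hgeom]; ring

end Summit.NavierStokesRegularity.FluidComputer.TriggeredTransfer

end
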